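/-
Origin: expansion seat `planner-pub-hodgecm-mc-glue-1-0`, handover #29 2026-08-18T19:05Z md5 e735bc52322df01751ad0f3821aec77d (NEW additive leaf, 175 l., junction J2c; PKG CLAIM window -> 19:15Z; INSTALL ONLY WITH/AFTER rows #2-#26 and #27 (imports HodgeCM.Model.Junction.QuotientModelTransport + HodgeCM.Vendored.H21.NumberTheory.Automorphic.LevelOrbitLiftMeasure); nothing landed imports it; as-landed rehearsal rc 0, 0 errors, 0 warnings, 0 proof holes; axioms tri (`HOME/mc/pub-hodgecm-mc-glue-1/aslanded/HodgeCM/Model/Junction/PieceEmbedding.lean`, md5 e735bc52, 175 lines);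
landed by the packager successor (mc-unitary-1-g3, gen-8 kit) in gate run 32 as `HodgeCM/Model/Junction/PieceEmbedding.lean` (verbatim).
-/
/-
Origin: speedrun cell pub-hodgecm, MODEL-CONSTRUCTION sub-cell, unit pub-hodgecm-mc-glue-1 (node E-J, junction J2c =
the automorphic half of `emb` for E2-INSTANCE-SPEC-prl1 §3 / mc-autform-2 HANDOFF §2), seat
planner-pub-hodgecm-mc-glue-1-0, 2026-08-18.
Target in PKG: HodgeCM/Model/Junction/PieceEmbedding.lean (NEW additive leaf; nothing landed imports it).
P0 NOTE: imports the vendored harness-tree module `LevelOrbitLiftMeasure` (mc-autform-2 D1-aut-ii, p177900) under its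
vendored name and this unit's junction J2 `QuotientModelTransport`.
-/
import Summits.HodgeConjecture.HodgeCM.Model.Junction.QuotientModelTransport
import Literature.NumberTheory.Automorphic.LevelOrbitLiftMeasure

/-!
# Junction J2c: the piece embedding `C(Λ\G_∞, ℂ) →ₗ[ℂ] Q.H`

For a package quotient model `Q` (`Q.H = L²(Q.G ⧸ Q.Γ, Q.ν)`), a model `e : G₁ ≃ₜ* Q.G` of its group with
`e⁻¹(Q.Γ) = Γ₁` (junction J1/J2: in PerL's regime `G₁ = U(H)(𝔸)`, `Γ₁ = U(H)(L⁺)`, `e = regimeEquiv`), an open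
subgroup `M ≤ G₁` with a continuous homomorphism `π : M →* A` (mc-autform-2's recipe: `M = splitLevel e' K`,
`π = splitProj e' K : M →* G_∞` for a compact open level `K`) and a base point `x : G₁ ⧸ Γ₁`, the tree's PIECE LIFT
`LevelOrbit.pieceLiftLp` (Getz–Hahn (6.8): a continuous function on the compact arithmetic quotient
`A ⧸ Λ`, `Λ = pieceLattice M Γ₁ π x`, extended by zero off the piece `M • x`, as an element of `L²(G₁ ⧸ Γ₁)`) composed
with the L² transport of junction J2 gives

* `Q.pieceEmb Γ₁ e hΓ M π x hM hπ : C(A ⧸ pieceLattice M Γ₁ π x, ℂ) →ₗ[ℂ] Q.H`;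
* `inner_pieceEmb` : `⟪pieceEmb f', pieceEmb f⟫ = ∫ conj (f' q) * f q ∂μ₁` with `μ₁ = pieceMeasure … (Q.pullbackν …)`
  — the Petersson side of `Fact_innerEmb`-type statements (`nonempty_thetaRealisation_at`, binder `h₂`), reduced to
  an integral over the arithmetic quotient;
* `norm_sq_pieceEmb`, `norm_pieceEmb`, `pieceEmb_eq_zero_iff`, and the a.e. representation `coeFn_pieceEmb`
  (`pieceEmb f = pieceLift f ∘ cosetCongr e⁻¹` a.e. on `Q.G ⧸ Q.Γ`).

So the E seat's `emb Γ` is `pieceEmb ∘ (class ↦ scalar weight function on Λ_K\G_∞)` (D1-G), and its two PRINT-shaped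
obligations split as: Petersson = `inner_pieceEmb` (kernel, here) ∘ (Petersson integral = cup pairing on
`H^{2,0}`, D1-G / h09b).  Everything is proved; 0 hypotheses beyond the data; 0 MODEL-N.
-/

set_option autoImplicit false

noncomputable section

open MeasureTheory Literature.MeasureTheory.Group Literature.NumberTheory.Automorphic
open scoped ENNReal InnerProductSpace

namespace HodgeCM

namespace QuotientModel

variable (Q : QuotientModel) {G₁ : Type*} [Group G₁] [TopologicalSpace G₁] [IsTopologicalGroup G₁]
  (Γ₁ : Subgroup G₁) (e : G₁ ≃ₜ* Q.G) (hΓ : ∀ g, e g ∈ Q.Γ ↔ g ∈ Γ₁)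
  [MeasurableSpace (G₁ ⧸ Γ₁)] [BorelSpace (G₁ ⧸ Γ₁)]
  (M : Subgroup G₁) {A : Type*} [Group A] [TopologicalSpace A] (π : M →* A) (x : G₁ ⧸ Γ₁)
  [MeasurableSpace (A ⧸ LevelOrbit.pieceLattice M Γ₁ π x)]
  [BorelSpace (A ⧸ LevelOrbit.pieceLattice M Γ₁ π x)]
  [CompactSpace (A ⧸ LevelOrbit.pieceLattice M Γ₁ π x)]

/-- **J2c — the piece embedding**: continuous functions on the compact arithmetic quotient
`A ⧸ pieceLattice M Γ₁ π x` ↦ `Q.H = L²(Q.G ⧸ Q.Γ, Q.ν)`, = (piece lift into `L²(G₁ ⧸ Γ₁, Q.pullbackν)`) followed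
by the L² transport along `e`. -/
def pieceEmb (hM : IsOpen (M : Set G₁)) (hπ : Continuous π) :
    C(A ⧸ LevelOrbit.pieceLattice M Γ₁ π x, ℂ) →ₗ[ℂ] Q.H :=
  Q.transportEmb Γ₁ e hΓ (LevelOrbit.pieceLiftLp ℂ M Γ₁ π x (Q.pullbackν Γ₁ e hΓ) 2 hM hπ)

omit [MeasurableSpace (A ⧸ LevelOrbit.pieceLattice M Γ₁ π x)]
  [BorelSpace (A ⧸ LevelOrbit.pieceLattice M Γ₁ π x)] in
/-- (Ported verbatim from the HodgeCMPerL package; no docstring in the source.) -/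
theorem pieceEmb_apply (hM : IsOpen (M : Set G₁)) (hπ : Continuous π)
    (f : C(A ⧸ LevelOrbit.pieceLattice M Γ₁ π x, ℂ)) :
    Q.pieceEmb Γ₁ e hΓ M π x hM hπ f =
      Q.transportL2 Γ₁ e hΓ (LevelOrbit.pieceLiftLp ℂ M Γ₁ π x (Q.pullbackν Γ₁ e hΓ) 2 hM hπ f) :=
  rfl

/-- **Petersson side of `Fact_innerEmb`**: the `L²([G])` inner product of two piece-embedded functions is the
integral of `conj f' · f` over the arithmetic quotient against the piece measure. -/
theorem inner_pieceEmb (hM : IsOpen (M : Set G₁)) (hπ : Continuous π)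
    (f' f : C(A ⧸ LevelOrbit.pieceLattice M Γ₁ π x, ℂ)) :
    ⟪Q.pieceEmb Γ₁ e hΓ M π x hM hπ f', Q.pieceEmb Γ₁ e hΓ M π x hM hπ f⟫_ℂ =
      ∫ q, ⟪f' q, f q⟫_ℂ ∂(LevelOrbit.pieceMeasure M Γ₁ π x (Q.pullbackν Γ₁ e hΓ)) := by
  rw [pieceEmb, inner_transportEmb]
  exact LevelOrbit.inner_pieceLiftLp M Γ₁ π x _ hM hπ f' f

/-- **Petersson norm**: `‖pieceEmb f‖² = ∫ ‖f q‖² dμ₁`. -/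
theorem norm_sq_pieceEmb (hM : IsOpen (M : Set G₁)) (hπ : Continuous π)
    (f : C(A ⧸ LevelOrbit.pieceLattice M Γ₁ π x, ℂ)) :
    ‖Q.pieceEmb Γ₁ e hΓ M π x hM hπ f‖ ^ 2 =
      ∫ q, ‖f q‖ ^ 2 ∂(LevelOrbit.pieceMeasure M Γ₁ π x (Q.pullbackν Γ₁ e hΓ)) := by
  rw [pieceEmb, norm_transportEmb]
  exact LevelOrbit.norm_sq_pieceLiftLp M Γ₁ π x _ hM hπ f

/-- (Ported verbatim from the HodgeCMPerL package; no docstring in the source.) -/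
theorem norm_pieceEmb (hM : IsOpen (M : Set G₁)) (hπ : Continuous π)
    (f : C(A ⧸ LevelOrbit.pieceLattice M Γ₁ π x, ℂ)) :
    ‖Q.pieceEmb Γ₁ e hΓ M π x hM hπ f‖ =
      (eLpNorm (f : A ⧸ LevelOrbit.pieceLattice M Γ₁ π x → ℂ) 2
        (LevelOrbit.pieceMeasure M Γ₁ π x (Q.pullbackν Γ₁ e hΓ))).toReal := by
  rw [pieceEmb, norm_transportEmb]
  exact LevelOrbit.norm_pieceLiftLp ℂ M Γ₁ π x _ 2 hM hπ f

omit [MeasurableSpace (A ⧸ LevelOrbit.pieceLattice M Γ₁ π x)]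
  [BorelSpace (A ⧸ LevelOrbit.pieceLattice M Γ₁ π x)] in
/-- `pieceEmb f = 0 ↔ pieceLiftLp f = 0` (the transport is an isometry). -/
theorem pieceEmb_eq_zero_iff (hM : IsOpen (M : Set G₁)) (hπ : Continuous π)
    (f : C(A ⧸ LevelOrbit.pieceLattice M Γ₁ π x, ℂ)) :
    Q.pieceEmb Γ₁ e hΓ M π x hM hπ f = 0 ↔
      LevelOrbit.pieceLiftLp ℂ M Γ₁ π x (Q.pullbackν Γ₁ e hΓ) 2 hM hπ f = 0 := by
  rw [← norm_eq_zero, pieceEmb, norm_transportEmb, norm_eq_zero]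

omit [MeasurableSpace (A ⧸ LevelOrbit.pieceLattice M Γ₁ π x)]
  [BorelSpace (A ⧸ LevelOrbit.pieceLattice M Γ₁ π x)] [CompactSpace (A ⧸ LevelOrbit.pieceLattice M Γ₁ π x)]
  [IsTopologicalGroup G₁] in
/-- `cosetCongr e⁻¹ : Q.G ⧸ Q.Γ → G₁ ⧸ Γ₁` is measure preserving from `Q.ν` to the pull-back (by definition of the
pull-back as a push-forward along it). -/
theorem measurePreserving_cosetCongr_symm_pullbackν :
    MeasurePreserving
      (cosetCongr e.symm.toMulEquiv Q.Γ Γ₁ (forall_symm_mem_iff e.toMulEquiv Γ₁ Q.Γ hΓ))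
      Q.ν (Q.pullbackν Γ₁ e hΓ) :=
  measurePreserving_cosetCongr_map e.symm.toMulEquiv Q.Γ Γ₁ _ e.symm.continuous Q.ν

omit [MeasurableSpace (A ⧸ LevelOrbit.pieceLattice M Γ₁ π x)]
  [BorelSpace (A ⧸ LevelOrbit.pieceLattice M Γ₁ π x)] in
/-- **A.e. representation on `[G]`**: `pieceEmb f = (pieceLift f) ∘ cosetCongr e⁻¹` almost everywhere for `Q.ν` —
the adelic function attached to `f` is the zero-extension of `f` off the piece, read through `e`. -/
theorem coeFn_pieceEmb (hM : IsOpen (M : Set G₁)) (hπ : Continuous π)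
    (f : C(A ⧸ LevelOrbit.pieceLattice M Γ₁ π x, ℂ)) :
    (Q.pieceEmb Γ₁ e hΓ M π x hM hπ f : Q.G ⧸ Q.Γ → ℂ) =ᵐ[Q.ν]
      LevelOrbit.pieceLift M Γ₁ π x f ∘ cosetCongr e.symm.toMulEquiv Q.Γ Γ₁
        (forall_symm_mem_iff e.toMulEquiv Γ₁ Q.Γ hΓ) := by
  have h1 := Q.coeFn_transportL2 Γ₁ e hΓ
    (LevelOrbit.pieceLiftLp ℂ M Γ₁ π x (Q.pullbackν Γ₁ e hΓ) 2 hM hπ f)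
  have h2 : (LevelOrbit.pieceLiftLp ℂ M Γ₁ π x (Q.pullbackν Γ₁ e hΓ) 2 hM hπ f : G₁ ⧸ Γ₁ → ℂ) =ᵐ[
      Q.pullbackν Γ₁ e hΓ] LevelOrbit.pieceLift M Γ₁ π x f :=
    LevelOrbit.coeFn_pieceLiftLp ℂ M Γ₁ π x _ 2 hM hπ f
  exact h1.trans
    ((Q.measurePreserving_cosetCongr_symm_pullbackν Γ₁ e hΓ).quasiMeasurePreserving.ae_eq_comp h2)

end QuotientModel

/-! ## In PerL's regime: `G₁ = U(H)(𝔸)`, `Γ₁ = U(H)(L⁺)`, `e = regimeEquiv` -/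

namespace HermSpace3

open HodgeCM.Adelic

variable (hP : PrintFact_unitaryCompact) {L : CMField} {ι₁ : L →+* ℂ} (V : HermSpace3 L ι₁)
  (h : IsAnisotropic L V.Hm)
  [MeasurableSpace (adelicUnitaryGroup L V.Hm ⧸ adelicUnitaryRat L V.Hm)]
  [BorelSpace (adelicUnitaryGroup L V.Hm ⧸ adelicUnitaryRat L V.Hm)]
  (M : Subgroup (adelicUnitaryGroup L V.Hm)) {A : Type*} [Group A] [TopologicalSpace A] (π : M →* A)
  (x : adelicUnitaryGroup L V.Hm ⧸ adelicUnitaryRat L V.Hm)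
  [MeasurableSpace (A ⧸ LevelOrbit.pieceLattice M (adelicUnitaryRat L V.Hm) π x)]
  [BorelSpace (A ⧸ LevelOrbit.pieceLattice M (adelicUnitaryRat L V.Hm) π x)]
  [CompactSpace (A ⧸ LevelOrbit.pieceLattice M (adelicUnitaryRat L V.Hm) π x)]

/-- **The piece embedding into the END-STATE carrier `(V.latticeModel hP).toQuotientModel.H`** (the codomain of
`AdelicThetaCore.emb Γ`), for a level piece of `U(H)(L⁺)\U(H)(𝔸)`. -/
def regimePieceEmb (hM : IsOpen (M : Set (adelicUnitaryGroup L V.Hm))) (hπ : Continuous π) :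
    C(A ⧸ LevelOrbit.pieceLattice M (adelicUnitaryRat L V.Hm) π x, ℂ) →ₗ[ℂ]
      (V.latticeModel hP).toQuotientModel.H :=
  (V.latticeModel hP).toQuotientModel.pieceEmb (adelicUnitaryRat L V.Hm) (regimeEquiv L V.Hm h)
    (V.regimeEquiv_mem_latticeModel_Γ_iff hP h) M π x hM hπ

/-- Petersson side of `h₂` (`Fact_innerEmb` AT `V`) in the regime: the inner product in the END-STATE carrier is the
integral over the arithmetic quotient against the piece measure of `V.regimeν hP h`. -/
theorem inner_regimePieceEmb (hM : IsOpen (M : Set (adelicUnitaryGroup L V.Hm))) (hπ : Continuous π)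
    (f' f : C(A ⧸ LevelOrbit.pieceLattice M (adelicUnitaryRat L V.Hm) π x, ℂ)) :
    ⟪V.regimePieceEmb hP h M π x hM hπ f', V.regimePieceEmb hP h M π x hM hπ f⟫_ℂ =
      ∫ q, ⟪f' q, f q⟫_ℂ ∂(LevelOrbit.pieceMeasure M (adelicUnitaryRat L V.Hm) π x (V.regimeν hP h)) :=
  QuotientModel.inner_pieceEmb _ _ _ _ M π x hM hπ f' f

/-- (Ported verbatim from the HodgeCMPerL package; no docstring in the source.) -/
theorem norm_sq_regimePieceEmb (hM : IsOpen (M : Set (adelicUnitaryGroup L V.Hm))) (hπ : Continuous π)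
    (f : C(A ⧸ LevelOrbit.pieceLattice M (adelicUnitaryRat L V.Hm) π x, ℂ)) :
    ‖V.regimePieceEmb hP h M π x hM hπ f‖ ^ 2 =
      ∫ q, ‖f q‖ ^ 2 ∂(LevelOrbit.pieceMeasure M (adelicUnitaryRat L V.Hm) π x (V.regimeν hP h)) :=
  QuotientModel.norm_sq_pieceEmb _ _ _ _ M π x hM hπ f

end HermSpace3

end HodgeCM

end
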